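import Summits.QuantumFields.YangMills.Theorems.UnitScaleTiltProp7LemmaHCurvedDirichletCount
import Literature.MathematicalPhysics.QuantumFieldTheory.Balaban1983to89.B5Ineq137Torus
import Literature.MathematicalPhysics.QuantumFieldTheory.Balaban1983to89.B9B8KnitAveragingClosenessAtCorner
import HarnessLib

/-!
# Route `UnitScaleTilt`, crux K1 «MinimiserStabilityRegPr» (stmt-QuantumFields-19200), route-R E′ path (α′), S3 K-form engine, row (R4′) — FILE 9m (T³ geometry):
# THE WINDOW ROWS OF THE (α) LETTER DISCHARGED — on the support of the blend (`y` within two blocks of the block of `z − s𝟙`) every fine site `z` and its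
# neighbours `z − e_μ` lie, relative to every offset base `c^h_y = c_y + h·e_ι` (`h < ℓ′`), in the window `[−(2ℓ+ℓ′), 2ℓ+ℓ′]^d` with no wrap-around, as soon as
# `2(2ℓ + ℓ′) < N` (period); hence ✓p675776 `lemmaH_curved_offset_avg_count` holds with its rows `hwrap`, `hbox` (and `hwin`) REMOVED.

Cell `ym3-torus`, D-0154 (3c) twin-width seat `ym-routeR-w1` (gen 6); row (R4′) (★★OWNER g28 interim word «assembly (α) GO»; standing PASS R4′).  THEOREMS ONLY (0 `def`, 0 `sorry`);
`--supports stmt-QuantumFields-19200`, count-neutral.  YM₃ on T³ is a ladder rung (R3), not the Clay problem; nothing here claims a stub, the crux, d = 4 or the gap.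

WHAT (ns `…Theorems.Prop7OffsetFamilyWindow`).
* §1 `valMinAbs_window` (pure `ZMod` bookkeeping: the least-absolute-value representative of `(w + s + a) − (ℓ·y + s + g)` when `y ≡ ⌊w/ℓ⌋ + δ (mod N/ℓ)` is `w % ℓ + a − ℓδ − g`),
  `rel_transl_embIter_apply` (the relative coordinate of `x = z + a` w.r.t. the base `embIter y + g` on the torus of record), `exists_delta_of_near` (the support predicate's
  disjunction as `y_ν = B_ν + δ`, `δ ∈ [−1,2]`).
* §2 ★★ `abs_rel_offset_le` ∕ `abs_rel_offset_unshift_le` (`|rel c^h_y z|_∞, |rel c^h_y (z − e_μ)|_∞ ≤ 2ℓ + ℓ′`), ★★ `offsetFamily_hbox`, ★★ `offsetFamily_hwrap` — the rows of ✓p675776 in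
  their displayed form.
* §3 ★★★ `lemmaH_curved_offset_avg_count_windowed` — ✓ `lemmaH_curved_offset_avg_count` with `hwin`, `hwrap`, `hbox` discharged (`R = 2ℓ + ℓ′`); remaining displayed rows: `hψ`
  (harmonicity off the centres), `hG` (the `G` group's pointwise row), the comb-order splits.
HONEST SCOPE.  Lattice geometry only; no estimate of the series.

References: T. Bałaban, CMP 109 (1987) 249–301 [Balaban1987RG1] ((0.1) pp.251–252); CMP 102 (1985) 255–275 [Balaban1985UV3] ((27) p.263); CMP 95 (1984) 17–40
[Balaban1984PropagatorsI] ((1.6) p.18).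
-/

set_option autoImplicit false

noncomputable section

open scoped BigOperators Matrix.Norms.L2Operator Matrix

namespace Summit.QuantumFields.YangMills.Theorems.Prop7OffsetFamilyWindow

open Literature.MathematicalPhysics.QuantumFieldTheory.Balaban1983to89
open Literature.MathematicalPhysics.QuantumFieldTheory.Balaban1983to89.T3ContinuumYM3Torus
open B7Prop1Explicit (Letter e e_apply seg treeWord hol)
open B9Eq39Adjoint (R covD covDstar divB)
open B9TorusCalculus (torusT torusT_symm_apply)
open B10Eq27TorusAxialLog (unitsField toUField holT axialT contourT rel rel_apply pull transl transl_apply)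
open B5Eq118OneStroke (iterBlockOf val_iterBlockOf)
open B15DeterminingSets (embIter)
open B5Ineq137Torus (pow_mul_sitesPerDir)
open B9B8KnitAveragingClosenessAtCorner (val_embIter)
open Summit.QuantumFields.YangMills.Theorems.Prop7LemmaHCurvedDirichletCount (lemmaH_curved_offset_avg_count)

/-! ## §1 `ZMod` bookkeeping -/

section ZModWindow

/-- the least-absolute-value representative of `X = (w + s + a) − (ℓ·yv + s + g)` in `ZMod N₀`, `N₀ = ℓN′`, when `yv ≡ ⌊w/ℓ⌋ + δ (mod N′)`: it is the integer
`w % ℓ + a − ℓδ − g` as soon as twice its size is below the period. [folklore] [cite: Balaban1987RG1, (0.1) p.251] -/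
theorem valMinAbs_window {N₀ N' ℓ : ℕ} [NeZero N₀] [NeZero N'] (hN : ℓ * N' = N₀) (w : ZMod N₀) (yv : ZMod N') (δ : ℤ)
    (hy : yv = (((w.val / ℓ : ℕ)) : ZMod N') + ((δ : ℤ) : ZMod N')) (s : ℕ) (a g : ℤ) (X : ZMod N₀)
    (hX : X = (((w.val + s : ℕ) : ZMod N₀) + ((a : ℤ) : ZMod N₀)) - ((((yv.val * ℓ + s : ℕ)) : ZMod N₀) + ((g : ℤ) : ZMod N₀)))
    (hsmall : ((((w.val % ℓ : ℕ)) : ℤ) + a - (ℓ : ℤ) * δ - g) * 2 ∈ Set.Ioc (-(N₀ : ℤ)) (N₀ : ℤ)) :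
    X.valMinAbs = (((w.val % ℓ : ℕ)) : ℤ) + a - (ℓ : ℤ) * δ - g := by
  have hq : (N' : ℤ) ∣ ((((w.val / ℓ : ℕ)) : ℤ) + δ) - (yv.val : ℤ) := by
    rw [← ZMod.intCast_eq_intCast_iff_dvd_sub, Int.cast_add, Int.cast_natCast, Int.cast_natCast, ZMod.natCast_zmod_val]
    exact hy
  have hN' : ((N₀ : ℕ) : ℤ) = (ℓ : ℤ) * (N' : ℤ) := by exact_mod_cast hN.symm
  have hq' : (N₀ : ℤ) ∣ (ℓ : ℤ) * ((((w.val / ℓ : ℕ)) : ℤ) + δ) - (((yv.val * ℓ : ℕ)) : ℤ) := by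
    rw [hN']
    obtain ⟨c, hc⟩ := hq
    exact ⟨c, by rw [Nat.cast_mul]; linear_combination (ℓ : ℤ) * hc⟩
  have hwv : (((w.val : ℕ)) : ℤ) = (ℓ : ℤ) * (((w.val / ℓ : ℕ)) : ℤ) + (((w.val % ℓ : ℕ)) : ℤ) := by
    exact_mod_cast (Nat.div_add_mod w.val ℓ).symm
  refine (ZMod.valMinAbs_spec X _).2 ⟨?_, hsmall⟩
  rw [hX, show (((w.val + s : ℕ) : ZMod N₀) + ((a : ℤ) : ZMod N₀)) - ((((yv.val * ℓ + s : ℕ)) : ZMod N₀) + ((g : ℤ) : ZMod N₀))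
      = ((((((w.val : ℕ)) : ℤ) + a - (((yv.val * ℓ : ℕ)) : ℤ) - g : ℤ)) : ZMod N₀) by push_cast; ring,
    ZMod.intCast_eq_intCast_iff_dvd_sub]
  have e1 : (((w.val % ℓ : ℕ)) : ℤ) + a - (ℓ : ℤ) * δ - g - ((((w.val : ℕ)) : ℤ) + a - (((yv.val * ℓ : ℕ)) : ℤ) - g)
      = -((ℓ : ℤ) * ((((w.val / ℓ : ℕ)) : ℤ) + δ) - (((yv.val * ℓ : ℕ)) : ℤ)) := by
    rw [hwv]; ring
  rw [e1, dvd_neg]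
  exact hq'

end ZModWindow

/-! ## §2 The window rows of the offset-comb family -/

section Torus

variable {P : Params}

/-- the relative coordinate of `x` (`x_ν = z_ν + a`) with respect to the base `embIter y + g` on the torus of record, when `y_ν = B_ν + δ` for the block `B` of `z − s𝟙`
(`s = (ℓ−1)/2`, `ℓ = L^k`): `rel (embIter y + g) x ν = (z_ν − s) % ℓ + a − ℓδ − g_ν` (no wrap as long as twice its size is below the period).
[cite: Balaban1987RG1, (0.1) pp.251–252] [cite: Balaban1984PropagatorsI, (1.6) p.18] [cite: Balaban1985UV3, (27) p.263] -/
theorem rel_transl_embIter_apply {k : ℕ} (hk : k ≤ P.m + P.K) (y : Site P k) (z x : Site P 0) (ν : Fin P.d) (δ a : ℤ) (g : B7Prop1Explicit.Site P.d)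
    (hy : y ν = iterBlockOf k (fun κ => z κ - ((((P.L ^ k - 1) / 2 : ℕ)) : ZMod (P.sitesPerDir 0))) ν + ((δ : ℤ) : ZMod (P.sitesPerDir k)))
    (hx : x ν = z ν + ((a : ℤ) : ZMod (P.sitesPerDir 0)))
    (hsmall : (((((z ν - ((((P.L ^ k - 1) / 2 : ℕ)) : ZMod (P.sitesPerDir 0))).val % P.L ^ k : ℕ)) : ℤ) + a - ((P.L ^ k : ℕ) : ℤ) * δ - g ν) * 2
      ∈ Set.Ioc (-(P.sitesPerDir 0 : ℤ)) (P.sitesPerDir 0 : ℤ)) :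
    rel (transl (embIter k y) g) x ν
      = ((((z ν - ((((P.L ^ k - 1) / 2 : ℕ)) : ZMod (P.sitesPerDir 0))).val % P.L ^ k : ℕ)) : ℤ) + a - ((P.L ^ k : ℕ) : ℤ) * δ - g ν := by
  set s : ℕ := (P.L ^ k - 1) / 2 with hs
  set w : ZMod (P.sitesPerDir 0) := z ν - ((s : ℕ) : ZMod (P.sitesPerDir 0)) with hw
  have hB : ((iterBlockOf k (fun κ => z κ - ((s : ℕ) : ZMod (P.sitesPerDir 0))) ν).val) = w.val / P.L ^ k :=
    val_iterBlockOf k hk _ ν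
  have hy' : y ν = (((w.val / P.L ^ k : ℕ)) : ZMod (P.sitesPerDir k)) + ((δ : ℤ) : ZMod (P.sitesPerDir k)) := by
    rw [hy, ← hB, ZMod.natCast_zmod_val]
  have hz : z ν = ((w.val + s : ℕ) : ZMod (P.sitesPerDir 0)) := by
    push_cast
    rw [ZMod.natCast_zmod_val, hw, sub_add_cancel]
  have hemb : embIter k y ν = ((((y ν).val * P.L ^ k + s : ℕ)) : ZMod (P.sitesPerDir 0)) := by
    rw [← val_embIter hk y ν, ZMod.natCast_zmod_val]
  rw [rel_apply]
  refine valMinAbs_window (pow_mul_sitesPerDir (P := P) hk) w (y ν) δ hy' s a (g ν) _ ?_ hsmall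
  rw [hx, hz, transl_apply, hemb]

/-- the support predicate's disjunction `y_ν ∈ {B_ν − 1, B_ν, B_ν + 1, B_ν + 2}` as `y_ν = B_ν + δ` with `δ ∈ [−1, 2]`. [folklore] -/
theorem exists_delta_of_near {N : ℕ} (yv B : ZMod N) (h : yv = B - 1 ∨ yv = B ∨ yv = B + 1 ∨ yv = B + 2) :
    ∃ δ : ℤ, -1 ≤ δ ∧ δ ≤ 2 ∧ yv = B + ((δ : ℤ) : ZMod N) := by
  rcases h with h | h | h | h
  · exact ⟨-1, le_rfl, by norm_num, by rw [h]; push_cast; ring⟩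
  · exact ⟨0, by norm_num, by norm_num, by rw [h]; push_cast; ring⟩
  · exact ⟨1, by norm_num, by norm_num, by rw [h]; push_cast; ring⟩
  · exact ⟨2, by norm_num, by norm_num, by rw [h]; push_cast; ring⟩

/-- ★★ **THE WINDOW**: on the support (`y` within two blocks of the block of `z − s𝟙`), for `x = z + a` with `a ∈ {0, −1}` and an offset `0 ≤ g_ν ≤ G` of the base,
`−(2ℓ + G + 1) ≤ rel (c_y + g) x ν ≤ 2ℓ − 1`, provided `2(2ℓ + G + 1) < N` (period). [cite: Balaban1987RG1, (0.1) pp.251–252] [cite: Balaban1985UV3, (27) p.263] -/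
theorem rel_offset_mem_Icc {k : ℕ} (hk : k ≤ P.m + P.K) (G : ℕ) (hN : (2 * P.L ^ k + G + 1) * 2 < P.sitesPerDir 0) (y : Site P k) (z x : Site P 0)
    (ν : Fin P.d) (g : B7Prop1Explicit.Site P.d) (hg0 : 0 ≤ g ν) (hgG : g ν ≤ (G : ℤ)) (a : ℤ) (ha : a = 0 ∨ a = -1)
    (hx : x ν = z ν + ((a : ℤ) : ZMod (P.sitesPerDir 0)))
    (hnear : y ν = iterBlockOf k (fun κ => z κ - ((((P.L ^ k - 1) / 2 : ℕ)) : ZMod (P.sitesPerDir 0))) ν - 1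
      ∨ y ν = iterBlockOf k (fun κ => z κ - ((((P.L ^ k - 1) / 2 : ℕ)) : ZMod (P.sitesPerDir 0))) ν
      ∨ y ν = iterBlockOf k (fun κ => z κ - ((((P.L ^ k - 1) / 2 : ℕ)) : ZMod (P.sitesPerDir 0))) ν + 1
      ∨ y ν = iterBlockOf k (fun κ => z κ - ((((P.L ^ k - 1) / 2 : ℕ)) : ZMod (P.sitesPerDir 0))) ν + 2) :
    -(((2 * P.L ^ k + G + 1 : ℕ)) : ℤ) ≤ rel (transl (embIter k y) g) x ν ∧ rel (transl (embIter k y) g) x ν ≤ 2 * ((P.L ^ k : ℕ) : ℤ) - 1 := by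
  obtain ⟨δ, hδ1, hδ2, hy⟩ := exists_delta_of_near _ _ hnear
  have hL : 0 < P.L := by obtain ⟨t, ht⟩ := P.hL.1; omega
  set ℓ : ℕ := P.L ^ k with hℓdef
  have hℓ : 0 < ℓ := pow_pos hL k
  set r : ℕ := ((z ν - ((((ℓ - 1) / 2 : ℕ)) : ZMod (P.sitesPerDir 0))).val % ℓ : ℕ) with hrdef
  have hr : r < ℓ := Nat.mod_lt _ hℓ
  have hr' : (r : ℤ) + 1 ≤ (ℓ : ℤ) := by exact_mod_cast hr
  have hℓ0 : (0 : ℤ) ≤ (ℓ : ℤ) := by exact_mod_cast hℓ.le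
  have hup : (ℓ : ℤ) * δ ≤ 2 * (ℓ : ℤ) := by nlinarith
  have hdn : -(ℓ : ℤ) ≤ (ℓ : ℤ) * δ := by nlinarith
  have hr0 : (0 : ℤ) ≤ (r : ℤ) := by exact_mod_cast Nat.zero_le r
  have hlo : -(((2 * ℓ + G + 1 : ℕ)) : ℤ) ≤ (r : ℤ) + a - (ℓ : ℤ) * δ - g ν := by
    push_cast; rcases ha with rfl | rfl <;> linarith
  have hhi : (r : ℤ) + a - (ℓ : ℤ) * δ - g ν ≤ 2 * (ℓ : ℤ) - 1 := by
    rcases ha with rfl | rfl <;> linarith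
  have hsmall : ((r : ℤ) + a - (ℓ : ℤ) * δ - g ν) * 2 ∈ Set.Ioc (-(P.sitesPerDir 0 : ℤ)) (P.sitesPerDir 0 : ℤ) := by
    have hN' : (((2 * ℓ + G + 1 : ℕ) : ℤ)) * 2 < (P.sitesPerDir 0 : ℤ) := by exact_mod_cast hN
    constructor <;> linarith
  rw [rel_transl_embIter_apply hk y z x ν δ a g hy hx hsmall]
  exact ⟨hlo, hhi⟩

/-- ★★ **THE WINDOW ROWS OF THE OFFSET-COMB FAMILY**: on the support (`y` within two blocks of the block of `z − s𝟙`), for every offset base `c^h_y = c_y + h·e_ι` (`h < ℓ′`):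
`|rel c^h_y z|_ν, |rel c^h_y (z − e_μ)|_ν ≤ 2ℓ + ℓ′` and `2(rel + 1) ≤ N` (no wrap-around), provided `2(2ℓ + ℓ′) < N` — the rows `hbox`, `hwrap` of ✓p675776
`lemmaH_curved_offset_avg_count`. [cite: Balaban1987RG1, (0.1) pp.251–252] [cite: Balaban1985UV3, (27) p.263] -/
theorem abs_rel_offset_le {k : ℕ} (hk : k ≤ P.m + P.K) (ℓ' : ℕ) (hN : (2 * P.L ^ k + ℓ') * 2 < P.sitesPerDir 0) (y : Site P k) (z : Site P 0)
    (hnear : ∀ ν : Fin P.d,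
      (y ν = iterBlockOf k (fun κ => z κ - ((((P.L ^ k - 1) / 2 : ℕ)) : ZMod (P.sitesPerDir 0))) ν - 1
      ∨ y ν = iterBlockOf k (fun κ => z κ - ((((P.L ^ k - 1) / 2 : ℕ)) : ZMod (P.sitesPerDir 0))) ν
      ∨ y ν = iterBlockOf k (fun κ => z κ - ((((P.L ^ k - 1) / 2 : ℕ)) : ZMod (P.sitesPerDir 0))) ν + 1
      ∨ y ν = iterBlockOf k (fun κ => z κ - ((((P.L ^ k - 1) / 2 : ℕ)) : ZMod (P.sitesPerDir 0))) ν + 2))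
    (η : Fin ℓ') (ι μ ν : Fin P.d) :
    |rel (transl (embIter k y) (((η : ℕ) : ℤ) • e ι)) z ν| ≤ ((2 * P.L ^ k + ℓ' : ℕ) : ℤ)
    ∧ |rel (transl (embIter k y) (((η : ℕ) : ℤ) • e ι)) ((torusT P 0 μ).symm z) ν| ≤ ((2 * P.L ^ k + ℓ' : ℕ) : ℤ)
    ∧ (rel (transl (embIter k y) (((η : ℕ) : ℤ) • e ι)) z ν + 1) * 2 ≤ (P.sitesPerDir 0 : ℤ)
    ∧ (rel (transl (embIter k y) (((η : ℕ) : ℤ) • e ι)) ((torusT P 0 μ).symm z) ν + 1) * 2 ≤ (P.sitesPerDir 0 : ℤ) := by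
  have hη := η.isLt
  have hG : (2 * P.L ^ k + (ℓ' - 1) + 1) * 2 < P.sitesPerDir 0 := by
    have : 2 * P.L ^ k + (ℓ' - 1) + 1 = 2 * P.L ^ k + ℓ' := by omega
    rw [this]; exact hN
  have hg0 : 0 ≤ ((((η : ℕ) : ℤ) • e ι) : B7Prop1Explicit.Site P.d) ν := by
    rw [Pi.smul_apply, smul_eq_mul, e_apply]; split_ifs <;> simp
  have hgG : ((((η : ℕ) : ℤ) • e ι) : B7Prop1Explicit.Site P.d) ν ≤ ((ℓ' - 1 : ℕ) : ℤ) := by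
    rw [Pi.smul_apply, smul_eq_mul, e_apply]
    have : ((η : ℕ) : ℤ) ≤ ((ℓ' - 1 : ℕ) : ℤ) := by exact_mod_cast (by omega : (η : ℕ) ≤ ℓ' - 1)
    split_ifs
    · simpa using this
    · simp
  have hx0 : z ν = z ν + (((0 : ℤ)) : ZMod (P.sitesPerDir 0)) := by simp
  have hx1 : ((torusT P 0 μ).symm z) ν = z ν + (((if ν = μ then -1 else 0 : ℤ)) : ZMod (P.sitesPerDir 0)) := by
    rw [torusT_symm_apply, Site.unshift]
    by_cases h : ν = μ
    · subst h; rw [Function.update_self, if_pos rfl]; push_cast; ring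
    · rw [Function.update_of_ne h, if_neg h]; simp
  have h0 := rel_offset_mem_Icc hk (ℓ' - 1) hG y z z ν (((η : ℕ) : ℤ) • e ι) hg0 hgG 0 (Or.inl rfl) hx0 (hnear ν)
  have h1 := rel_offset_mem_Icc hk (ℓ' - 1) hG y z ((torusT P 0 μ).symm z) ν (((η : ℕ) : ℤ) • e ι) hg0 hgG (if ν = μ then -1 else 0)
    (by split_ifs <;> simp) hx1 (hnear ν)
  have hc : (((2 * P.L ^ k + (ℓ' - 1) + 1 : ℕ)) : ℤ) = ((2 * P.L ^ k + ℓ' : ℕ) : ℤ) := by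
    exact_mod_cast (by omega : 2 * P.L ^ k + (ℓ' - 1) + 1 = 2 * P.L ^ k + ℓ')
  rw [hc] at h0 h1
  have hN' : (((2 * P.L ^ k + ℓ' : ℕ)) : ℤ) * 2 < (P.sitesPerDir 0 : ℤ) := by exact_mod_cast hN
  have hℓc : (((2 * P.L ^ k + ℓ' : ℕ)) : ℤ) = 2 * ((P.L ^ k : ℕ) : ℤ) + (ℓ' : ℤ) := by push_cast; ring
  have hℓ'0 : (0 : ℤ) ≤ (ℓ' : ℤ) := by positivity
  rw [hℓc] at hN'
  refine ⟨abs_le.2 ⟨h0.1, ?_⟩, abs_le.2 ⟨h1.1, ?_⟩, ?_, ?_⟩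
  · rw [hℓc]; linarith [h0.2]
  · rw [hℓc]; linarith [h1.2]
  · linarith [h0.2]
  · linarith [h1.2]

end Torus

/-! ## §3 The (α) letter with its window rows discharged -/

section T3

/-- ★★★ **THE (α) LETTER, WINDOWED**: ✓p675776 `lemmaH_curved_offset_avg_count` with the rows `hwin`, `hwrap`, `hbox` DISCHARGED by ✓ `abs_rel_offset_le` at `R = 2ℓ + ℓ′` under the single
period row `2(2ℓ + ℓ′) < N`; remaining displayed rows: `hψ` (harmonicity off the centres), `hG` (the `G` group's pointwise row), the comb-order splits.
[cite: Balaban1985Averaging, (9) p.18, (19)–(20) p.21, p.24] [cite: Balaban1985UV3, (27) p.263] [cite: Balaban1987RG1, (0.1) pp.251–252] -/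
theorem lemmaH_curved_offset_avg_count_windowed (F : T3Family) (K n : ℕ) (hk : K - n ≤ (F.P K).m + (F.P K).K) (hℓ2 : 2 ≤ (F.P K).L ^ (K - n))
    (W : GaugeField (F.P K) 0 (Matrix.specialUnitaryGroup (Fin 2) ℂ)) (ψ : Site (F.P K) 0 → Matrix (Fin 2) (Fin 2) ℂ)
    (hψ : ∀ x : Site (F.P K) 0, x ∉ Set.range (embIter (K - n)) →
      divB (torusT (F.P K) 0) (fun κ z => unitsField (toUField W) ⟨z, κ⟩) (fun κ y => covD (torusT (F.P K) 0) (fun κ z => unitsField (toUField W) ⟨z, κ⟩) κ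
        (fun z => divB (torusT (F.P K) 0) (fun κ z => unitsField (toUField W) ⟨z, κ⟩)
          (fun ν w => covD (torusT (F.P K) 0) (fun κ z => unitsField (toUField W) ⟨z, κ⟩) ν ψ w) z) y) x = 0)
    (ι : Fin (F.P K).d) (ℓ' : ℕ) [NeZero ℓ'] (hN : (2 * (F.P K).L ^ (K - n) + ℓ') * 2 < (F.P K).sitesPerDir 0)
    (Z : Fin (F.P K).d → Site (F.P K) 0 → Matrix (Fin 2) (Fin 2) ℂ) (G : Site (F.P K) (K - n) → ℝ)
    (hG : ∀ (y : Site (F.P K) (K - n)) (z : Site (F.P K) 0),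
      (∀ ν : Fin (F.P K).d,
        (y ν = (iterBlockOf (K - n) (fun κ => z κ - (((((F.P K).L ^ (K - n) - 1) / 2 : ℕ)) : ZMod ((F.P K).sitesPerDir 0)))) ν - 1
        ∨ y ν = (iterBlockOf (K - n) (fun κ => z κ - (((((F.P K).L ^ (K - n) - 1) / 2 : ℕ)) : ZMod ((F.P K).sitesPerDir 0)))) ν
        ∨ y ν = (iterBlockOf (K - n) (fun κ => z κ - (((((F.P K).L ^ (K - n) - 1) / 2 : ℕ)) : ZMod ((F.P K).sitesPerDir 0)))) ν + 1
        ∨ y ν = (iterBlockOf (K - n) (fun κ => z κ - (((((F.P K).L ^ (K - n) - 1) / 2 : ℕ)) : ZMod ((F.P K).sitesPerDir 0)))) ν + 2)) →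
      ∀ μ : Fin (F.P K).d, ‖(ℓ' : ℝ)⁻¹ • ∑ η : Fin ℓ', R (axialT (unitsField (toUField W)) (transl (embIter (K - n) y) (((η : ℕ) : ℤ) • e ι)) z)⁻¹ (R (holT (unitsField (toUField W)) (embIter (K - n) y) (seg ι ((η : ℕ) : ℤ)))⁻¹ (ψ (embIter (K - n) y))) - Z μ z‖ ≤ G y)
    (s t : Fin (F.P K).d → List (Fin (F.P K).d)) (hsplit : ∀ μ, (List.finRange (F.P K).d).reverse = s μ ++ μ :: t μ) (hs : ∀ μ, μ ∉ s μ) (ht : ∀ μ, μ ∉ t μ) :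
    (F.L : ℝ) ^ (K - n) * ∑ x : Site (F.P K) 0, ∑ a : Fin 2, ∑ b : Fin 2,
        Complex.normSq ((divB (torusT (F.P K) 0) (fun κ z => unitsField (toUField W) ⟨z, κ⟩)
          (fun κ y => covD (torusT (F.P K) 0) (fun κ z => unitsField (toUField W) ⟨z, κ⟩) κ ψ y) x) a b)
      ≤ (F.L : ℝ) ^ (K - n) * (2 * (
          3 * ∑ y : Site (F.P K) (K - n), ∑ z : Site (F.P K) 0,
            (if (∀ ν : Fin (F.P K).d,
                (y ν = (iterBlockOf (K - n) (fun κ => z κ - (((((F.P K).L ^ (K - n) - 1) / 2 : ℕ)) : ZMod ((F.P K).sitesPerDir 0)))) ν - 1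
                ∨ y ν = (iterBlockOf (K - n) (fun κ => z κ - (((((F.P K).L ^ (K - n) - 1) / 2 : ℕ)) : ZMod ((F.P K).sitesPerDir 0)))) ν
                ∨ y ν = (iterBlockOf (K - n) (fun κ => z κ - (((((F.P K).L ^ (K - n) - 1) / 2 : ℕ)) : ZMod ((F.P K).sitesPerDir 0)))) ν + 1
                ∨ y ν = (iterBlockOf (K - n) (fun κ => z κ - (((((F.P K).L ^ (K - n) - 1) / 2 : ℕ)) : ZMod ((F.P K).sitesPerDir 0)))) ν + 2))
              then (ℓ' : ℝ)⁻¹ * ∑ η : Fin ℓ', (∑ μ : Fin (F.P K).d,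
                      (‖(((holT (unitsField (toUField W)) (transl (embIter (K - n) y) (((η : ℕ) : ℤ) • e ι)) (contourT (transl (embIter (K - n) y) (((η : ℕ) : ℤ) • e ι)) ⟨(torusT (F.P K) 0 μ).symm z, μ⟩))⁻¹
                            * holT (unitsField (toUField W)) (transl (embIter (K - n) y) (((η : ℕ) : ℤ) • e ι)) (contourT (transl (embIter (K - n) y) (((η : ℕ) : ℤ) • e ι)) ⟨z, μ⟩) : (Matrix (Fin 2) (Fin 2) ℂ)ˣ) : Matrix (Fin 2) (Fin 2) ℂ) * R (holT (unitsField (toUField W)) (embIter (K - n) y) (seg ι ((η : ℕ) : ℤ)))⁻¹ (ψ (embIter (K - n) y))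
                        - R (holT (unitsField (toUField W)) (embIter (K - n) y) (seg ι ((η : ℕ) : ℤ)))⁻¹ (ψ (embIter (K - n) y)) * (((holT (unitsField (toUField W)) (transl (embIter (K - n) y) (((η : ℕ) : ℤ) • e ι)) (contourT (transl (embIter (K - n) y) (((η : ℕ) : ℤ) • e ι)) ⟨(torusT (F.P K) 0 μ).symm z, μ⟩))⁻¹
                            * holT (unitsField (toUField W)) (transl (embIter (K - n) y) (((η : ℕ) : ℤ) • e ι)) (contourT (transl (embIter (K - n) y) (((η : ℕ) : ℤ) • e ι)) ⟨z, μ⟩) : (Matrix (Fin 2) (Fin 2) ℂ)ˣ) : Matrix (Fin 2) (Fin 2) ℂ)‖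
                        + 2 * ‖((holT (unitsField (toUField W)) (transl (embIter (K - n) y) (((η : ℕ) : ℤ) • e ι)) (contourT (transl (embIter (K - n) y) (((η : ℕ) : ℤ) • e ι)) ⟨(torusT (F.P K) 0 μ).symm z, μ⟩) :
                                (Matrix (Fin 2) (Fin 2) ℂ)ˣ) : Matrix (Fin 2) (Fin 2) ℂ) - 1‖
                          * ‖((holT (unitsField (toUField W)) (transl (embIter (K - n) y) (((η : ℕ) : ℤ) • e ι)) (contourT (transl (embIter (K - n) y) (((η : ℕ) : ℤ) • e ι)) ⟨(torusT (F.P K) 0 μ).symm z, μ⟩) :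
                                (Matrix (Fin 2) (Fin 2) ℂ)ˣ) : Matrix (Fin 2) (Fin 2) ℂ) * R (holT (unitsField (toUField W)) (embIter (K - n) y) (seg ι ((η : ℕ) : ℤ)))⁻¹ (ψ (embIter (K - n) y))
                              - R (holT (unitsField (toUField W)) (embIter (K - n) y) (seg ι ((η : ℕ) : ℤ)))⁻¹ (ψ (embIter (K - n) y)) * ((holT (unitsField (toUField W)) (transl (embIter (K - n) y) (((η : ℕ) : ℤ) • e ι)) (contourT (transl (embIter (K - n) y) (((η : ℕ) : ℤ) • e ι)) ⟨(torusT (F.P K) 0 μ).symm z, μ⟩) :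
                                (Matrix (Fin 2) (Fin 2) ℂ)ˣ) : Matrix (Fin 2) (Fin 2) ℂ)‖)) ^ 2
              else 0)
          + 3 * (2 * ((F.P K).d : ℝ) * (6 / ((((F.P K).L ^ (K - n) : ℕ) : ℝ)))) * (3 / ((((F.P K).L ^ (K - n) : ℕ) : ℝ)))
            * ∑ y : Site (F.P K) (K - n), (ℓ' : ℝ)⁻¹ * ∑ η : Fin ℓ', (2 * ∑ μ : Fin (F.P K).d,
              ((((t μ).length * (2 * (F.P K).L ^ (K - n) + ℓ') : ℕ) : ℝ) * ∑ i ∈ Finset.range (t μ).length, (((2 * (2 * (F.P K).L ^ (K - n) + ℓ') + 1) ^ ((t μ).length - i) : ℕ) : ℝ)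
                * ∑ q ∈ Fintype.piFinset (fun _ : Fin (F.P K).d => Finset.Icc (-((2 * (F.P K).L ^ (K - n) + ℓ') : ℤ)) ((2 * (F.P K).L ^ (K - n) + ℓ') : ℤ)),
                    (‖((hol (pull (unitsField (toUField W)) (transl (embIter (K - n) y) (((η : ℕ) : ℤ) • e ι))) q [((t μ).getD i μ, true), (μ, true), Letter.rev ((t μ).getD i μ, true), (μ, false)] : (Matrix (Fin 2) (Fin 2) ℂ)ˣ) : Matrix (Fin 2) (Fin 2) ℂ)
                        * R (hol (pull (unitsField (toUField W)) (transl (embIter (K - n) y) (((η : ℕ) : ℤ) • e ι))) 0 (treeWord q))⁻¹ (R (holT (unitsField (toUField W)) (embIter (K - n) y) (seg ι ((η : ℕ) : ℤ)))⁻¹ (ψ (embIter (K - n) y)))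
                      - R (hol (pull (unitsField (toUField W)) (transl (embIter (K - n) y) (((η : ℕ) : ℤ) • e ι))) 0 (treeWord q))⁻¹ (R (holT (unitsField (toUField W)) (embIter (K - n) y) (seg ι ((η : ℕ) : ℤ)))⁻¹ (ψ (embIter (K - n) y)))
                        * ((hol (pull (unitsField (toUField W)) (transl (embIter (K - n) y) (((η : ℕ) : ℤ) • e ι))) q [((t μ).getD i μ, true), (μ, true), Letter.rev ((t μ).getD i μ, true), (μ, false)] : (Matrix (Fin 2) (Fin 2) ℂ)ˣ) : Matrix (Fin 2) (Fin 2) ℂ)‖ ^ 2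
                    + ‖((hol (pull (unitsField (toUField W)) (transl (embIter (K - n) y) (((η : ℕ) : ℤ) • e ι))) q [((t μ).getD i μ, false), (μ, true), Letter.rev ((t μ).getD i μ, false), (μ, false)] : (Matrix (Fin 2) (Fin 2) ℂ)ˣ) : Matrix (Fin 2) (Fin 2) ℂ)
                        * R (hol (pull (unitsField (toUField W)) (transl (embIter (K - n) y) (((η : ℕ) : ℤ) • e ι))) 0 (treeWord q))⁻¹ (R (holT (unitsField (toUField W)) (embIter (K - n) y) (seg ι ((η : ℕ) : ℤ)))⁻¹ (ψ (embIter (K - n) y)))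
                      - R (hol (pull (unitsField (toUField W)) (transl (embIter (K - n) y) (((η : ℕ) : ℤ) • e ι))) 0 (treeWord q))⁻¹ (R (holT (unitsField (toUField W)) (embIter (K - n) y) (seg ι ((η : ℕ) : ℤ)))⁻¹ (ψ (embIter (K - n) y)))
                        * ((hol (pull (unitsField (toUField W)) (transl (embIter (K - n) y) (((η : ℕ) : ℤ) • e ι))) q [((t μ).getD i μ, false), (μ, true), Letter.rev ((t μ).getD i μ, false), (μ, false)] : (Matrix (Fin 2) (Fin 2) ℂ)ˣ) : Matrix (Fin 2) (Fin 2) ℂ)‖ ^ 2)))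
          + 3 * ((F.P K).d : ℝ) ^ 2 * (24 / ((((F.P K).L ^ (K - n) : ℕ) : ℝ)) ^ 2)
            * (24 / ((((F.P K).L ^ (K - n) : ℕ) : ℝ)) ^ 2 * ((((F.P K).L ^ (K - n) : ℕ) : ℝ)) ^ (F.P K).d) * ∑ y : Site (F.P K) (K - n), G y ^ 2)) := by
  have hwin : ℓ' * 2 ≤ (F.P K).sitesPerDir 0 := by omega
  exact lemmaH_curved_offset_avg_count F K n hk hℓ2 W ψ hψ ι ℓ' hwin
    (fun η y z hz μ => ⟨(abs_rel_offset_le hk ℓ' hN y z hz η ι μ μ).2.2.1, (abs_rel_offset_le hk ℓ' hN y z hz η ι μ μ).2.2.2⟩) Z G hG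
    (2 * (F.P K).L ^ (K - n) + ℓ') (fun η y z hz μ ν => ⟨(abs_rel_offset_le hk ℓ' hN y z hz η ι μ ν).1, (abs_rel_offset_le hk ℓ' hN y z hz η ι μ ν).2.1⟩)
    s t hsplit hs ht

end T3

end Summit.QuantumFields.YangMills.Theorems.Prop7OffsetFamilyWindow

end
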